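import Summits.ValiantsHypothesis.ValiantsHypothesis.Theses.GrenetZeon
import Literature.Computability.AlgebraicComplexity.AlgDetRepr
import HarnessLib

/-!
# Crux `GrenetZeon.PolySizeQPAlgebra` (stmt-ValiantsHypothesis-8064), line `vbp-slice-dealg` —
# ADDITIVITY of the two-parameter model and the rung "no quasi-polynomial sum of polynomial-size
# determinants" below the piece

The coefficient-algebra model is additive in the dimension parameter: representations over `R₁`
and `R₂` of the same size add up to one over `R₁ × R₂` (`hasAlgDetRepr_add`:
`(m, s) + (m, s') ↦ (m, s + s')`; `hasAlgDetRepr_finset_sum`).  Consequently a linear combination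
of `s` affine determinants of size `m` is an `(m, s)`-representation over the split semisimple
algebra `K^s` (`hasAlgDetRepr_sum_dets`), and conversely every representation over `K^s` is such a
linear combination (`eq_sum_dets_of_repr_pi`): the SEMISIMPLE SLICE of the model is the classical
"sums of determinants" model.

For the piece this types a rung strictly between its `s = 1` slice (`VNP ⊄ VBP`: no polynomial-size
determinant) and the piece itself:

* `not_sum_dets_of_polySizeQPAlgebra` — `PolySizeQPAlgebra` implies: for every `c`, for all large
  `n`, `per_n` is NOT a linear combination of `s ≤ 2^((log₂ n + c)^c)` affine determinants of size
  `m ≤ n^c + c` ("no quasi-polynomially long sum of polynomial-size determinants").  Such a sum has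
  determinantal complexity only quasi-polynomial, so the rung is not implied by the `s = 1` slice;
  it is the semisimple (`R = ℂ^s`) case of the piece, open like the piece (record: Mignon–Ressayre
  at `s = 1`).

Honest framing: API for the model and one typed rung (an implication between open statements);
nothing here is progress on VP ≠ VNP.  Axioms `propext`, `Classical.choice`, `Quot.sound`.

## References
* P. Hrubeš, A. Yehudayoff, *Arithmetic complexity in ring extensions*, Theory of Computing 7
  (2011), §2 (the dimension of the extension as the cost parameter). [HrubesYehudayoff2011]
* T. Mignon, N. Ressayre, *A quadratic bound for the determinant and permanent problem*, IMRN
  2004, §1. [MignonRessayre2004]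
-/

set_option linter.dupNamespace false

noncomputable section

namespace Summit.ValiantsHypothesis.ValiantsHypothesis.Theorems.GrenetZeonPolySizeQPAlgebra

open MvPolynomial Matrix
open Literature.Computability.AlgebraicComplexity
open Summit.ValiantsHypothesis.ValiantsHypothesis.Theses.GrenetZeon

universe u v

section Additivity

variable {K : Type u} [Field K] {σ : Type v}

/-- Scaling the read-out functional: an `(m, s)`-representation of `f` is one of `C a * f`
(replace `λ` by `a • λ`). [folklore] -/
theorem hasAlgDetRepr_constMul {f : MvPolynomial σ K} {m s : ℕ} (h : HasAlgDetRepr f m s) (a : K) :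
    HasAlgDetRepr (C a * f) m s := by
  obtain ⟨R, _, _, _, hR, l, A, hA, hf⟩ := h
  exact ⟨R, inferInstance, inferInstance, inferInstance, hR, a • l, A, hA, fun d => by
    rw [LinearMap.smul_apply, hf, coeff_C_mul, smul_eq_mul]⟩

/-- Coefficientwise pairing of a polynomial over `R₁` and one over `R₂` into a polynomial over
`R₁ × R₂` (the two coefficientwise embeddings `AddMonoidHom.inl`, `AddMonoidHom.inr`, summed);
its coefficients, definitional up to `Prod` arithmetic. [folklore] -/
theorem coeff_pairPoly {R₁ R₂ : Type u} [CommRing R₁] [CommRing R₂] (p : MvPolynomial σ R₁)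
    (q : MvPolynomial σ R₂) (d : σ →₀ ℕ) :
    coeff d ((AddMonoidAlgebra.map (AddMonoidHom.inl R₁ R₂) p : MvPolynomial σ (R₁ × R₂)) +
        (AddMonoidAlgebra.map (AddMonoidHom.inr R₁ R₂) q : MvPolynomial σ (R₁ × R₂))) =
      (coeff d p, coeff d q) := by
  rw [coeff_add]
  show (coeff d p, (0 : R₂)) + ((0 : R₁), coeff d q) = _
  rw [Prod.mk_add_mk, add_zero, zero_add]

/-- The pairing projects back to its components under `map fst` / `map snd`. [folklore] -/
theorem map_fst_pairPoly {R₁ R₂ : Type u} [CommRing R₁] [CommRing R₂] (p : MvPolynomial σ R₁)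
    (q : MvPolynomial σ R₂) :
    MvPolynomial.map (RingHom.fst R₁ R₂)
        ((AddMonoidAlgebra.map (AddMonoidHom.inl R₁ R₂) p : MvPolynomial σ (R₁ × R₂)) +
          (AddMonoidAlgebra.map (AddMonoidHom.inr R₁ R₂) q : MvPolynomial σ (R₁ × R₂))) = p :=
  MvPolynomial.ext _ _ fun d => by rw [coeff_map, coeff_pairPoly]; rfl

/-- The pairing projects back to its components under `map fst` / `map snd`. [folklore] -/
theorem map_snd_pairPoly {R₁ R₂ : Type u} [CommRing R₁] [CommRing R₂] (p : MvPolynomial σ R₁)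
    (q : MvPolynomial σ R₂) :
    MvPolynomial.map (RingHom.snd R₁ R₂)
        ((AddMonoidAlgebra.map (AddMonoidHom.inl R₁ R₂) p : MvPolynomial σ (R₁ × R₂)) +
          (AddMonoidAlgebra.map (AddMonoidHom.inr R₁ R₂) q : MvPolynomial σ (R₁ × R₂))) = q :=
  MvPolynomial.ext _ _ fun d => by rw [coeff_map, coeff_pairPoly]; rfl

/-- The pairing of two affine forms is affine (its support is contained in the union of the
supports). [folklore] -/
theorem totalDegree_pairPoly_le {R₁ R₂ : Type u} [CommRing R₁] [CommRing R₂]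
    (p : MvPolynomial σ R₁) (q : MvPolynomial σ R₂) {e : ℕ} (hp : p.totalDegree ≤ e)
    (hq : q.totalDegree ≤ e) :
    MvPolynomial.totalDegree
        ((AddMonoidAlgebra.map (AddMonoidHom.inl R₁ R₂) p : MvPolynomial σ (R₁ × R₂)) +
          (AddMonoidAlgebra.map (AddMonoidHom.inr R₁ R₂) q : MvPolynomial σ (R₁ × R₂))) ≤ e := by
  rw [MvPolynomial.totalDegree]
  refine Finset.sup_le fun d hd => ?_
  rw [mem_support_iff, coeff_pairPoly] at hd
  by_cases hp0 : coeff d p = 0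
  · have hq0 : coeff d q ≠ 0 := fun h => hd (by rw [hp0, h]; rfl)
    exact (le_totalDegree (mem_support_iff.mpr hq0)).trans hq
  · exact (le_totalDegree (mem_support_iff.mpr hp0)).trans hp

/-- **Additivity of the model in the dimension parameter.** If `f` has an `(m, s)`-representation
(over `R₁`, read through `λ₁`) and `g` an `(m, s')`-representation (over `R₂`, through `λ₂`), then
`f + g` has an `(m, s + s')`-representation: over `R₁ × R₂` (`finrank` adds, `Module.finrank_prod`),
with the entrywise PAIRED matrix (its `det` projects to `det A₁`, `det A₂` under the two ring
projections, `RingHom.map_det`) read through `λ₁ ∘ fst + λ₂ ∘ snd`.  (Hrubeš–Yehudayoff's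
dimension count for a product of extensions.) [cite: HrubesYehudayoff2011, §2] -/
theorem hasAlgDetRepr_add {f g : MvPolynomial σ K} {m s s' : ℕ} (hf : HasAlgDetRepr f m s)
    (hg : HasAlgDetRepr g m s') : HasAlgDetRepr (f + g) m (s + s') := by
  obtain ⟨R₁, _, _, _, hR₁, l₁, A₁, hA₁, hf₁⟩ := hf
  obtain ⟨R₂, _, _, _, hR₂, l₂, A₂, hA₂, hf₂⟩ := hg
  let A : Matrix (Fin m) (Fin m) (MvPolynomial σ (R₁ × R₂)) := fun i j =>
    (AddMonoidAlgebra.map (AddMonoidHom.inl R₁ R₂) (A₁ i j) : MvPolynomial σ (R₁ × R₂)) +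
      (AddMonoidAlgebra.map (AddMonoidHom.inr R₁ R₂) (A₂ i j) : MvPolynomial σ (R₁ × R₂))
  have hA1 : (MvPolynomial.map (RingHom.fst R₁ R₂)).mapMatrix A = A₁ :=
    Matrix.ext fun i j => map_fst_pairPoly (A₁ i j) (A₂ i j)
  have hA2 : (MvPolynomial.map (RingHom.snd R₁ R₂)).mapMatrix A = A₂ :=
    Matrix.ext fun i j => map_snd_pairPoly (A₁ i j) (A₂ i j)
  have hdet1 : MvPolynomial.map (RingHom.fst R₁ R₂) A.det = A₁.det := by
    rw [RingHom.map_det, hA1]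
  have hdet2 : MvPolynomial.map (RingHom.snd R₁ R₂) A.det = A₂.det := by
    rw [RingHom.map_det, hA2]
  refine ⟨R₁ × R₂, inferInstance, inferInstance, inferInstance, ?_,
    l₁.comp (LinearMap.fst K R₁ R₂) + l₂.comp (LinearMap.snd K R₁ R₂), A, fun i j => ?_, fun d => ?_⟩
  · rw [Module.finrank_prod]; exact Nat.add_le_add hR₁ hR₂
  · exact totalDegree_pairPoly_le _ _ (hA₁ i j) (hA₂ i j)
  · have h1 : (coeff d A.det).1 = coeff d A₁.det := by
      rw [← hdet1, coeff_map]; rfl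
    have h2 : (coeff d A.det).2 = coeff d A₂.det := by
      rw [← hdet2, coeff_map]; rfl
    rw [LinearMap.add_apply, LinearMap.comp_apply, LinearMap.comp_apply, LinearMap.fst_apply,
      LinearMap.snd_apply, h1, h2, hf₁, hf₂, coeff_add]

/-- **Finite additivity**: a sum of polynomials with `(m, s_a)`-representations has an
`(m, Σ s_a)`-representation. [cite: HrubesYehudayoff2011, §2] -/
theorem hasAlgDetRepr_finset_sum {α : Type*} (t : Finset α) (F : α → MvPolynomial σ K) (m : ℕ)
    (s : α → ℕ) (h : ∀ a ∈ t, HasAlgDetRepr (F a) m (s a)) :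
    HasAlgDetRepr (∑ a ∈ t, F a) m (∑ a ∈ t, s a) := by
  classical
  induction t using Finset.induction_on with
  | empty => rw [Finset.sum_empty, Finset.sum_empty]; exact hasAlgDetRepr_zero m 0
  | insert a t hat ih =>
    rw [Finset.sum_insert hat, Finset.sum_insert hat]
    exact hasAlgDetRepr_add (h a (Finset.mem_insert_self a t))
      (ih fun b hb => h b (Finset.mem_insert_of_mem hb))

/-- **Sums of determinants are representations over the split semisimple algebra.** A linear
combination `Σ_{i<s} α_i det A_i` of `s` affine determinants of size `m` has an
`(m, s)`-representation (each summand is an `(m, 1)`-representation over `K`,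
`HasDetRepr.hasAlgDetRepr`; add them up over `K^s`). [cite: MignonRessayre2004, §1] -/
theorem hasAlgDetRepr_sum_dets {m s : ℕ} (A : Fin s → Matrix (Fin m) (Fin m) (MvPolynomial σ K))
    (hA : ∀ i j k, (A i j k).totalDegree ≤ 1) (α : Fin s → K) :
    HasAlgDetRepr (∑ i, C (α i) * (A i).det) m s := by
  have h := hasAlgDetRepr_finset_sum Finset.univ (fun i => C (α i) * (A i).det) m (fun _ => 1)
    fun i _ => hasAlgDetRepr_constMul (HasDetRepr.hasAlgDetRepr ⟨A i, hA i, rfl⟩) (α i)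
  simpa only [Finset.sum_const, Finset.card_univ, Fintype.card_fin, smul_eq_mul, mul_one] using h

/-- **Conversely, a representation over the split semisimple algebra `K^s` IS a sum of `s` scaled
determinants**: if `λ (coeff_d det A) = coeff_d f` for a matrix `A` of affine forms over
`R = (Fin s → K)`, then `f = Σ_i λ(e_i) · det A^{(i)}` with `A^{(i)}` the `i`-th component matrix
(`RingHom.map_det` along the evaluation `R → K` at `i`, and `r = Σ_i r_i e_i`). [folklore] -/
theorem eq_sum_dets_of_repr_pi {m s : ℕ} {f : MvPolynomial σ K} (l : (Fin s → K) →ₗ[K] K)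
    (A : Matrix (Fin m) (Fin m) (MvPolynomial σ (Fin s → K)))
    (hf : ∀ d : σ →₀ ℕ, l (coeff d A.det) = coeff d f) :
    f = ∑ i, C (l (Pi.single i 1)) *
      ((MvPolynomial.map (Pi.evalRingHom (fun _ => K) i)).mapMatrix A).det := by
  classical
  refine MvPolynomial.ext _ _ fun d => ?_
  rw [← hf d, coeff_sum]
  have hr : coeff d A.det = ∑ i, (coeff d A.det) i • Pi.single (M := fun _ => K) i (1 : K) :=
    pi_eq_sum_univ' _
  rw [hr, map_sum]
  refine Finset.sum_congr rfl fun i _ => ?_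
  rw [map_smul, smul_eq_mul, coeff_C_mul, mul_comm, ← RingHom.map_det, coeff_map]
  rfl

end Additivity

/-! ### The rung below the piece: no quasi-polynomial sum of polynomial-size determinants -/

/-- **`PolySizeQPAlgebra` ⟹ `per_n` is not a quasi-polynomially long linear combination of
polynomial-size affine determinants**: for every `c`, for all large `n`, for `s ≤ 2^((log₂ n + c)^c)`
affine matrices `A_i` of size `m ≤ n^c + c` and scalars `α_i`, `per_n ≠ Σ_i α_i det A_i`
(`hasAlgDetRepr_sum_dets`: such a sum is an `(m, s)`-representation over `ℂ^s` — the semisimple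
slice of the piece).  Its `s = 1` case is the `VNP ⊄ VBP` slice; a quasi-polynomial sum of
polynomial-size determinants has only quasi-polynomial determinantal complexity, so this rung is not
a consequence of the slice. [cite: MignonRessayre2004, §1] -/
theorem not_sum_dets_of_polySizeQPAlgebra (hP : PolySizeQPAlgebra) (c : ℕ) :
    ∃ n₀ : ℕ, ∀ n ≥ n₀, ∀ m s : ℕ, m ≤ n ^ c + c → s ≤ 2 ^ ((Nat.log 2 n + c) ^ c) →
      ∀ (A : Fin s → Matrix (Fin m) (Fin m) (MvPolynomial (Fin n × Fin n) ℂ)) (α : Fin s → ℂ),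
        (∀ i j k, (A i j k).totalDegree ≤ 1) →
          perPoly (Fin n) ℂ ≠ ∑ i, C (α i) * (A i).det := by
  obtain ⟨n₀, h⟩ := hP c
  refine ⟨n₀, fun n hn m s hm hs A α hA hper => h n hn m s hm hs ?_⟩
  have hrep : HasAlgDetRepr (∑ i, C (α i) * (A i).det) m s := hasAlgDetRepr_sum_dets A hA α
  rw [← hper] at hrep
  exact hrep

/-- The same rung read against the route TARGET `AlgDcQP` (quasi-polynomial size AND
quasi-polynomially many summands): `AlgDcQP` implies that for every `c`, for all large `n`, `per_n`
is not a linear combination of `s ≤ 2^((log₂ n + c)^c)` affine determinants of size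
`m ≤ 2^((log₂ n + c)^c)`. [cite: MignonRessayre2004, §1] -/
theorem not_qpsum_qpdets_of_algDcQP (hA : AlgDcQP) (c : ℕ) :
    ∃ n₀ : ℕ, ∀ n ≥ n₀, ∀ m s : ℕ, m ≤ 2 ^ ((Nat.log 2 n + c) ^ c) →
      s ≤ 2 ^ ((Nat.log 2 n + c) ^ c) →
        ∀ (A : Fin s → Matrix (Fin m) (Fin m) (MvPolynomial (Fin n × Fin n) ℂ)) (α : Fin s → ℂ),
          (∀ i j k, (A i j k).totalDegree ≤ 1) →
            perPoly (Fin n) ℂ ≠ ∑ i, C (α i) * (A i).det := by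
  obtain ⟨n₀, h⟩ := hA c
  refine ⟨n₀, fun n hn m s hm hs A α hA' hper => h n hn m s hm hs ?_⟩
  have hrep : HasAlgDetRepr (∑ i, C (α i) * (A i).det) m s := hasAlgDetRepr_sum_dets A hA' α
  rw [← hper] at hrep
  exact hrep

end Summit.ValiantsHypothesis.ValiantsHypothesis.Theorems.GrenetZeonPolySizeQPAlgebra

end
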